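import Summits.Ventures.YMGap.RobustBall.CentreBlindMembers
import Summits.Ventures.YMGap.RobustBall.CentreSchur
import Summits.Ventures.YMGap.RobustBall.StringTensionOnBall
import HarnessLib

/-!
# Robust ball (Y2), §6(c) — STRING TENSION OF CENTRE-BLIND FAMILIES: the infinite-volume form of the centre-blind area law

HONEST FRAMING: venture file of the cell `pub-ymgap` (QuantumFields programme), track ROBUST-BALL / DS seat ds-4 (g7).
Strong-coupling LATTICE statements; nothing about the continuum, a spectral mass gap, or Clay.

WHAT.  `CentreBlindAreaLaw` proves the window-free, ball-free torus area law `AreaLawCentreBlind N d β` for every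
`N ≥ 2` and `2(d−1)N|β| < 1`: ONE pair `(C, c) = (2, −log max(2(d−1)N|β|, 1/2))` bounds `|⟨W_{R×T}⟩_{β,W,L}| ≤ C^{2(R+T)} e^{−cRT}`
for EVERY torus `L` and EVERY linkwise centre-blind perturbation `W` OF ANY SIZE.  Exactly as rb-p2 did for the tier-1 ball
(`StringTensionOnBall`, whose generic passage `hasAreaLawWith_of_torusBound` is reused verbatim), the volume-uniform bound passes
to every INFINITE-VOLUME LIMIT STATE (`PerturbedLimitStates.perturbedLimitPoints β 𝓦`, non-empty by compactness) of every family
`𝓦` that is eventually centre-blind (resp. twist-blind), landing in the tree's `ℤ^d` currencies of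
`Literature/MathematicalPhysics/QuantumLattice/WilsonLoops.lean`:
* `hasAreaLawWith_centreBlind` / `stringTension_centreBlind` — from the currency `AreaLawCentreBlind N d β` (`d ≥ 2`): every limit
  state `μ` of every eventually-centre-blind family obeys `HasAreaLawWith μ χ_N C c`, hence `HasAreaLawState μ χ_N`, string tension
  `σ ≥ c` WHENEVER IT EXISTS (`HasStringTension μ χ_N σ`), and `IsConfining μ χ_N` given existence; `d = 4` reading
  `c ≤ suFundStringTension N μ` (`suFundStringTension_ge_centreBlind`);
* `stringTension_twistBlind` — the same, unconditionally, for every `N ≥ 2`, `d ≥ 2`, `2(d−1)N|β| < 1` and every eventually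
  TWIST-BLIND family (the weaker, concrete hypothesis the proofs run on), with the explicit constants;
* ★ `stringTension_adjointAction` — THE ADJOINT AXIS, UNIFORMLY IN THE SIZE: for every `N ≥ 2`, `d ≥ 2`, `2(d−1)N|β| < 1` there is ONE
  `c > 0` (independent of `t`) such that for EVERY `t ∈ ℝ`, every family whose members are eventually plaquette actions of the tree's
  adjoint density `adjointDensity N t` (`Targets.lean` (w2): Wilson `+ t·∑_p (|tr U_p|² − 1)/(N² − 1)`), and every infinite-volume
  limit state `μ` of it: `HasAreaLawWith μ χ_N 2 c`, and `σ ≥ c` whenever the string tension exists — Fröhlich's 1979 statement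
  «ℤ_N confinement ⇒ confinement of every centre-blind modification, whatever its size» in kernel form at strong coupling; such
  families EXIST on every torus `L ≥ 3` (`exists_adjointAction_family`, from `CentreBlindMembers.exists_adjointAction_member`), so the
  statement is not vacuous, and their limit states exist (`perturbedLimitPoints_nonempty`);
* by Schur (`CentreSchur.isCentreBlind_iff_isTwistBlind`) the named families are centre-blind IN rb-theory's SENSE:
  `isCentreBlind_of_adjointAction`, `isCentreBlind_of_su2_mixedAction`, `exists_adjointAction_centreBlind_member` — so the
  currency-level theorems apply to them by name;
* rows: `SU(2)`, `d = 4`, `|β| < 1/12` (`β_W < 1/6`) for the adjoint axis and for the mixed action `t·(Re tr U_p)²`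
  (`su2_stringTension_adjointAction_dim4`, `su2_stringTension_mixedAction_dim4`); `SU(3)`, `d = 4`, `|β| < 1/18`;
* consistency (`W = 0`): every tree `infiniteVolumeLimitPoints (fundamentalRep (Fin N)) β` limit point of the WILSON states obeys
  `HasAreaLawWith` with the same constants (`wilson_hasAreaLawWith_of_small`), every `N ≥ 2`, `d ≥ 2`.
WHAT IS NOT CLAIMED.  EXISTENCE of the static potential / string tension of a limit state of a perturbed family is NOT proved
(no reflection positivity is available for a general member); every string-tension clause is «whenever it exists», and the
unconditional content is the `ℤ^d` area law `HasAreaLawWith` of every limit state.  The `β`-window `2(d−1)N|β| < 1` is SMALLER than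
tier 1's; the gain is the absence of any smallness condition on the perturbation.  No DLR property or uniqueness of the limit
states is used or claimed.  Loops: rectangles in the `(0,1)` plane based at the origin (the tree's currency).

References (mechanism, AS PRINTED): J. Fröhlich, Phys. Lett. B 83 (1979) 195–198 [Frohlich1979ZN]; G. Mack, V. B. Petkova,
Ann. Phys. 123 (1979) 442–467 [MackPetkova1979]; E. Seiler, LNP 159 (1982) §2 for the string-tension notions.
-/

noncomputable section

open MeasureTheory Filter Topology
open Literature.MathematicalPhysics.QuantumLattice
open Literature.MathematicalPhysics.QuantumFieldTheory hiding ZdEdge Site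
open Literature.Barriers.QuantumFields (suFundStringTension suFundStringTension_def)

namespace Summit.Ventures.YMGap.RobustBall

variable {d L N : ℕ}

/-! ### From the currency `AreaLawCentreBlind` -/

/-- **CENTRE-BLIND AREA LAW ⇒ `ℤ^d` AREA LAW OF EVERY LIMIT STATE, SAME CONSTANTS.**  If `AreaLawCentreBlind N d β` (`d ≥ 2`),
there are `C` and `c > 0` such that for every family `𝓦` whose members are, for all large torus sizes, linkwise centre-blind,
every infinite-volume limit state `μ ∈ perturbedLimitPoints β 𝓦` satisfies `HasAreaLawWith μ χ_N C c`:
`|W_μ(R,T)| ≤ C^{2(R+T)} e^{−cRT}` for all `R, T ≥ 1`. [folklore] -/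
theorem hasAreaLawWith_centreBlind [NeZero d] (hd : 2 ≤ d) {β : ℝ} (h : AreaLawCentreBlind N d β) :
    ∃ C c : ℝ, 0 < c ∧ ∀ 𝓦 : PerturbationFamily d N,
      (∀ᶠ L : ℕ in atTop, IsCentreBlind (𝓦 L)) →
        ∀ μ ∈ perturbedLimitPoints β 𝓦,
          HasAreaLawWith μ (fun g => normalisedCharacter N (fundamentalRep (Fin N) g)) C c := by
  obtain ⟨C, c, hc, hA⟩ := h
  refine ⟨C, c, hc, fun 𝓦 h𝓦 μ hμ => hasAreaLawWith_of_torusBound (β := β)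
    (fun L => {W : Perturbation d (L + 1) N | IsCentreBlind W}) (fun L W hW R T hR hT hRL hTL => ?_) 𝓦
    (h𝓦.mono fun L hL => hL) hμ⟩
  exact hA (L + 1) W hW 0 0 1 R T (fin_zero_ne_one_of_two_le hd) hR hT hRL hTL

/-- **STRING TENSION OF CENTRE-BLIND FAMILIES.**  Under `AreaLawCentreBlind N d β` (`d ≥ 2`) there is ONE pair `(C, c)`, `c > 0`,
such that every infinite-volume limit state `μ` of every eventually-centre-blind family: (i) obeys `HasAreaLawWith μ χ_N C c`
(so `HasAreaLawState μ χ_N`); (ii) has string tension `σ ≥ c` WHENEVER the string tension exists (`HasStringTension μ χ_N σ`; tree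
`HasAreaLawWith.le_of_hasStringTension`, Seiler LNP 159 §2); (iii) is confining (`IsConfining μ χ_N`) as soon as its string tension
exists.  Existence of `σ` is NOT asserted. [folklore] -/
theorem stringTension_centreBlind [NeZero d] (hd : 2 ≤ d) {β : ℝ} (h : AreaLawCentreBlind N d β) :
    ∃ C c : ℝ, 0 < c ∧ ∀ 𝓦 : PerturbationFamily d N,
      (∀ᶠ L : ℕ in atTop, IsCentreBlind (𝓦 L)) →
        ∀ μ ∈ perturbedLimitPoints β 𝓦,
          HasAreaLawWith μ (fun g => normalisedCharacter N (fundamentalRep (Fin N) g)) C c ∧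
          HasAreaLawState μ (fun g => normalisedCharacter N (fundamentalRep (Fin N) g)) ∧
          (∀ σ : ℝ, HasStringTension μ (fun g => normalisedCharacter N (fundamentalRep (Fin N) g)) σ → c ≤ σ) ∧
          ((∃ σ : ℝ, HasStringTension μ (fun g => normalisedCharacter N (fundamentalRep (Fin N) g)) σ) →
            IsConfining μ (fun g => normalisedCharacter N (fundamentalRep (Fin N) g))) := by
  obtain ⟨C, c, hc, hA⟩ := hasAreaLawWith_centreBlind hd h
  refine ⟨C, c, hc, fun 𝓦 h𝓦 μ hμ => ?_⟩
  have hW := hA 𝓦 h𝓦 μ hμ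
  exact ⟨hW, ⟨C, c, hc, hW⟩, fun σ hσ => hW.le_of_hasStringTension hσ,
    fun hσ => HasAreaLawState.isConfining ⟨C, c, hc, hW⟩ hσ⟩

/-- The `d = 4` reading in the tree's named string tension `suFundStringTension N μ`: under `AreaLawCentreBlind N 4 β`, one `c > 0`
bounds from below the fundamental string tension of every limit state of every eventually-centre-blind family whose string tension
exists: `c ≤ suFundStringTension N μ`. [folklore] -/
theorem suFundStringTension_ge_centreBlind {β : ℝ} (h : AreaLawCentreBlind N 4 β) :
    ∃ C c : ℝ, 0 < c ∧ ∀ 𝓦 : PerturbationFamily 4 N,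
      (∀ᶠ L : ℕ in atTop, IsCentreBlind (𝓦 L)) →
        ∀ μ ∈ perturbedLimitPoints β 𝓦,
          HasAreaLawWith μ (fun g => normalisedCharacter N (fundamentalRep (Fin N) g)) C c ∧
          ((∃ σ : ℝ, HasStringTension μ (fun g => normalisedCharacter N (fundamentalRep (Fin N) g)) σ) →
            c ≤ suFundStringTension N μ) := by
  obtain ⟨C, c, hc, hA⟩ := hasAreaLawWith_centreBlind (N := N) (by norm_num) h
  refine ⟨C, c, hc, fun 𝓦 h𝓦 μ hμ => ⟨hA 𝓦 h𝓦 μ hμ, fun ⟨σ, hσ⟩ => ?_⟩⟩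
  rw [suFundStringTension_def, hσ.stringTension_eq]
  exact (hA 𝓦 h𝓦 μ hμ).le_of_hasStringTension hσ

/-! ### Unconditionally, for twist-blind families, with the explicit constants -/

/-- **STRING TENSION OF TWIST-BLIND FAMILIES, explicit constants** (`N ≥ 2`, `d ≥ 2`, `c₀ = 2(d−1)N|β| < 1`; `C = 2`,
`c = −log max(c₀, 1/2) > 0`): every infinite-volume limit state `μ` of every family that is eventually TWIST-BLIND (in particular
eventually linkwise centre-blind: `IsCentreBlind.isTwistBlind`) obeys `HasAreaLawWith μ χ_N 2 c`, and `σ ≥ c` whenever its string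
tension `σ` exists. [folklore] -/
theorem stringTension_twistBlind [NeZero d] [NeZero N] (hd : 2 ≤ d) (hN : 2 ≤ N) {β : ℝ}
    (hβ : 2 * ((d - 1 : ℕ) : ℝ) * |β| * N < 1) :
    ∀ 𝓦 : PerturbationFamily d N, (∀ᶠ L : ℕ in atTop, IsTwistBlind (𝓦 L)) →
      ∀ μ ∈ perturbedLimitPoints β 𝓦,
        HasAreaLawWith μ (fun g => normalisedCharacter N (fundamentalRep (Fin N) g)) 2
            (-Real.log (max (2 * ((d - 1 : ℕ) : ℝ) * |β| * N) (1 / 2))) ∧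
        (∀ σ : ℝ, HasStringTension μ (fun g => normalisedCharacter N (fundamentalRep (Fin N) g)) σ →
            -Real.log (max (2 * ((d - 1 : ℕ) : ℝ) * |β| * N) (1 / 2)) ≤ σ) ∧
        ((∃ σ : ℝ, HasStringTension μ (fun g => normalisedCharacter N (fundamentalRep (Fin N) g)) σ) →
            IsConfining μ (fun g => normalisedCharacter N (fundamentalRep (Fin N) g))) := by
  set c := max (2 * ((d - 1 : ℕ) : ℝ) * |β| * N) (1 / 2) with hcdef
  have hc0 : 0 < c := lt_max_of_lt_right (by norm_num)
  have hc1 : c < 1 := max_lt hβ (by norm_num)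
  have hcle : 2 * ((d - 1 : ℕ) : ℝ) * |β| * N ≤ c := le_max_left _ _
  have hpos : 0 < -Real.log c := neg_pos.2 (Real.log_neg hc0 hc1)
  intro 𝓦 h𝓦 μ hμ
  have hW : HasAreaLawWith μ (fun g => normalisedCharacter N (fundamentalRep (Fin N) g)) 2 (-Real.log c) :=
    hasAreaLawWith_of_torusBound (β := β) (fun L => {W : Perturbation d (L + 1) N | IsTwistBlind W})
      (fun L W hW R T _ _ hRL hTL =>
        (abs_wilsonLoop_le_of_isTwistBlind hN hcle hc1.le W hW 0 (fin_zero_ne_one_of_two_le hd) hRL hTL).trans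
          (pow_bound_le_areaLawShape hc0 R T))
      𝓦 (h𝓦.mono fun L hL => hL) hμ
  exact ⟨hW, fun σ hσ => hW.le_of_hasStringTension hσ,
    fun hσ => HasAreaLawState.isConfining ⟨2, -Real.log c, hpos, hW⟩ hσ⟩

/-! ### The named members are centre-blind in rb-theory's sense (Schur, `CentreSchur`) -/

/-- **Every adjoint plaquette action is centre-blind in rb-theory's sense** (`IsCentreBlind`, arbitrary centre-valued link
twists), at ANY size `t`: `IsPlaquetteAction (adjointDensity N t) W → IsCentreBlind W`. [folklore] -/
theorem isCentreBlind_of_adjointAction [NeZero L] [NeZero N] {t : ℝ} {W : Perturbation d L N}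
    (hW : IsPlaquetteAction (adjointDensity N t) W) : IsCentreBlind W :=
  (isTwistBlind_of_adjointAction hW).isCentreBlind

/-- **Every `SU(2)` mixed plaquette action `t·∑_p (Re tr U_p)²` is centre-blind in rb-theory's sense**, any `t`. [folklore] -/
theorem isCentreBlind_of_su2_mixedAction [NeZero L] {t : ℝ} {W : Perturbation d L 2}
    (hW : IsPlaquetteAction (su2MixedDensity t) W) : IsCentreBlind W :=
  (isTwistBlind_of_su2_mixedAction hW).isCentreBlind

/-- **The SU(N) adjoint action of ANY size exists as a CENTRE-BLIND, plaquette-local member of rb-theory's carrier** on every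
torus `L ≥ 3` (`N ≥ 2`) — the membership statement of `CentreBlindMembers.exists_adjointAction_member` in the reserved predicate.
[folklore] -/
theorem exists_adjointAction_centreBlind_member [NeZero N] (hN : 2 ≤ N) (t : ℝ) (L : ℕ) [NeZero L] (hL : 3 ≤ L) :
    ∃ W : Perturbation d L N, IsPlaquetteAction (adjointDensity N t) W ∧ IsPlaquetteLocal W ∧ IsCentreBlind W := by
  obtain ⟨W, hact, hloc, htw⟩ := exists_adjointAction_member (d := d) hN t L hL
  exact ⟨W, hact, hloc, htw.isCentreBlind⟩

/-! ### ★ The adjoint axis, uniformly in the size -/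

/-- **CONFINEMENT ALONG THE WHOLE ADJOINT AXIS, UNIFORMLY IN THE SIZE** (`N ≥ 2`, `d ≥ 2`, `c₀ = 2(d−1)N|β| < 1`, rate
`c = −log max(c₀, 1/2)` INDEPENDENT of `t`): for EVERY `t ∈ ℝ`, every family whose members are eventually plaquette actions of the
adjoint density `adjointDensity N t` (Wilson `+ t·∑_p (|tr U_p|² − 1)/(N² − 1)`), and every infinite-volume limit state `μ` of it:
`HasAreaLawWith μ χ_N 2 c`; `σ ≥ c` whenever the string tension `σ` exists; `IsConfining μ χ_N` given existence.  The kernel form, at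
strong coupling, of Fröhlich's «ℤ_N confinement implies confinement of every centre-blind modification of the action».
[cite: Frohlich1979ZN, Eq. (7)–(9)] -/
theorem stringTension_adjointAction [NeZero d] [NeZero N] (hd : 2 ≤ d) (hN : 2 ≤ N) {β : ℝ}
    (hβ : 2 * ((d - 1 : ℕ) : ℝ) * |β| * N < 1) (t : ℝ) :
    ∀ 𝓦 : PerturbationFamily d N, (∀ᶠ L : ℕ in atTop, IsPlaquetteAction (adjointDensity N t) (𝓦 L)) →
      ∀ μ ∈ perturbedLimitPoints β 𝓦,
        HasAreaLawWith μ (fun g => normalisedCharacter N (fundamentalRep (Fin N) g)) 2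
            (-Real.log (max (2 * ((d - 1 : ℕ) : ℝ) * |β| * N) (1 / 2))) ∧
        (∀ σ : ℝ, HasStringTension μ (fun g => normalisedCharacter N (fundamentalRep (Fin N) g)) σ →
            -Real.log (max (2 * ((d - 1 : ℕ) : ℝ) * |β| * N) (1 / 2)) ≤ σ) ∧
        ((∃ σ : ℝ, HasStringTension μ (fun g => normalisedCharacter N (fundamentalRep (Fin N) g)) σ) →
            IsConfining μ (fun g => normalisedCharacter N (fundamentalRep (Fin N) g))) := by
  intro 𝓦 h𝓦
  exact stringTension_twistBlind hd hN hβ 𝓦 (h𝓦.mono fun L hL => isTwistBlind_of_adjointAction hL)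

/-- **ADJOINT FAMILIES EXIST** (so the statement above is not vacuous): for every `N ≥ 2` and `t`, a family of perturbations that is,
from torus size `3` on, a plaquette action of `adjointDensity N t`, plaquette-local, and centre-blind in rb-theory's sense
(`exists_adjointAction_centreBlind_member`, by choice). [folklore] -/
theorem exists_adjointAction_family [NeZero N] (hN : 2 ≤ N) (t : ℝ) :
    ∃ 𝓦 : PerturbationFamily d N, ∀ᶠ L : ℕ in atTop,
      IsPlaquetteAction (adjointDensity N t) (𝓦 L) ∧ IsPlaquetteLocal (𝓦 L) ∧ IsCentreBlind (𝓦 L) := by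
  classical
  refine ⟨fun L => if hL : 3 ≤ L + 1 then
    Classical.choose (exists_adjointAction_centreBlind_member (d := d) hN t (L + 1) hL) else 0, ?_⟩
  filter_upwards [eventually_ge_atTop 2] with L hL
  have hL' : 3 ≤ L + 1 := by omega
  simp only [hL', dite_true]
  exact Classical.choose_spec (exists_adjointAction_centreBlind_member (d := d) hN t (L + 1) hL')

/-- **THE ADJOINT AXIS HAS CONFINING LIMIT STATES AT EVERY SIZE** (`N ≥ 2`, `d ≥ 2`, `2(d−1)N|β| < 1`, every `t ∈ ℝ`): there is an
adjoint-action family of size `t` whose set of infinite-volume limit states is non-empty and all of whose limit states obey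
`HasAreaLawWith μ χ_N 2 c` with the `t`-independent rate `c = −log max(2(d−1)N|β|, 1/2) > 0` (and `σ ≥ c` whenever the string tension
exists). [folklore] -/
theorem exists_adjointAction_family_confining [NeZero d] [NeZero N] (hd : 2 ≤ d) (hN : 2 ≤ N) {β : ℝ}
    (hβ : 2 * ((d - 1 : ℕ) : ℝ) * |β| * N < 1) (t : ℝ) :
    ∃ 𝓦 : PerturbationFamily d N,
      (∀ᶠ L : ℕ in atTop, IsPlaquetteAction (adjointDensity N t) (𝓦 L) ∧ IsPlaquetteLocal (𝓦 L) ∧ IsCentreBlind (𝓦 L)) ∧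
      (perturbedLimitPoints β 𝓦).Nonempty ∧
      0 < -Real.log (max (2 * ((d - 1 : ℕ) : ℝ) * |β| * N) (1 / 2)) ∧
      ∀ μ ∈ perturbedLimitPoints β 𝓦,
        HasAreaLawWith μ (fun g => normalisedCharacter N (fundamentalRep (Fin N) g)) 2
            (-Real.log (max (2 * ((d - 1 : ℕ) : ℝ) * |β| * N) (1 / 2))) ∧
        (∀ σ : ℝ, HasStringTension μ (fun g => normalisedCharacter N (fundamentalRep (Fin N) g)) σ →
            -Real.log (max (2 * ((d - 1 : ℕ) : ℝ) * |β| * N) (1 / 2)) ≤ σ) := by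
  obtain ⟨𝓦, h𝓦⟩ := exists_adjointAction_family (d := d) hN t
  have hc0 : 0 < max (2 * ((d - 1 : ℕ) : ℝ) * |β| * N) (1 / 2) := lt_max_of_lt_right (by norm_num)
  have hc1 : max (2 * ((d - 1 : ℕ) : ℝ) * |β| * N) (1 / 2) < 1 := max_lt hβ (by norm_num)
  refine ⟨𝓦, h𝓦, perturbedLimitPoints_nonempty β 𝓦, neg_pos.2 (Real.log_neg hc0 hc1), fun μ hμ => ?_⟩
  have h := stringTension_adjointAction hd hN hβ t 𝓦 (h𝓦.mono fun L hL => hL.1) μ hμ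
  exact ⟨h.1, h.2.1⟩

/-! ### Rows -/

/-- **SU(2), `d = 4`, `|β| < 1/12` (`β_W < 1/6`), the adjoint axis at EVERY size `t`**: every limit state of every
eventually-`adjointDensity 2 t` family obeys `HasAreaLawWith μ χ₂ 2 c`, `c = −log max(12|β|, 1/2)`, and `c ≤ suFundStringTension 2 μ`
whenever the string tension exists. [folklore] -/
theorem su2_stringTension_adjointAction_dim4 {β : ℝ} (hβ : |β| < 1 / 12) (t : ℝ) :
    ∀ 𝓦 : PerturbationFamily 4 2, (∀ᶠ L : ℕ in atTop, IsPlaquetteAction (adjointDensity 2 t) (𝓦 L)) →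
      ∀ μ ∈ perturbedLimitPoints β 𝓦,
        HasAreaLawWith μ (fun g => normalisedCharacter 2 (fundamentalRep (Fin 2) g)) 2
            (-Real.log (max (12 * |β|) (1 / 2))) ∧
        ((∃ σ : ℝ, HasStringTension μ (fun g => normalisedCharacter 2 (fundamentalRep (Fin 2) g)) σ) →
            -Real.log (max (12 * |β|) (1 / 2)) ≤ suFundStringTension 2 μ) := by
  intro 𝓦 h𝓦 μ hμ
  have h := stringTension_adjointAction (d := 4) (N := 2) (by norm_num) le_rfl (β := β) (by push_cast; linarith) t 𝓦 h𝓦 μ hμ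
  have e : (2 * ((4 - 1 : ℕ) : ℝ) * |β| * (2 : ℕ)) = 12 * |β| := by push_cast; ring
  rw [e] at h
  refine ⟨h.1, fun ⟨σ, hσ⟩ => ?_⟩
  rw [suFundStringTension_def, hσ.stringTension_eq]
  exact h.2.1 σ hσ

/-- **SU(2), `d = 4`, `|β| < 1/12`, the MIXED action `t·∑_p (Re tr U_p)²` at EVERY size `t`** (`CentreBlindMembers.su2MixedDensity`):
every limit state of every eventually-`su2MixedDensity t` family obeys `HasAreaLawWith μ χ₂ 2 c`, `c = −log max(12|β|, 1/2)`, and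
`σ ≥ c` whenever its string tension exists. [folklore] -/
theorem su2_stringTension_mixedAction_dim4 {β : ℝ} (hβ : |β| < 1 / 12) (t : ℝ) :
    ∀ 𝓦 : PerturbationFamily 4 2, (∀ᶠ L : ℕ in atTop, IsPlaquetteAction (su2MixedDensity t) (𝓦 L)) →
      ∀ μ ∈ perturbedLimitPoints β 𝓦,
        HasAreaLawWith μ (fun g => normalisedCharacter 2 (fundamentalRep (Fin 2) g)) 2
            (-Real.log (max (12 * |β|) (1 / 2))) ∧
        (∀ σ : ℝ, HasStringTension μ (fun g => normalisedCharacter 2 (fundamentalRep (Fin 2) g)) σ →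
            -Real.log (max (12 * |β|) (1 / 2)) ≤ σ) := by
  intro 𝓦 h𝓦 μ hμ
  have h := stringTension_twistBlind (d := 4) (N := 2) (by norm_num) le_rfl (β := β) (by push_cast; linarith) 𝓦
    (h𝓦.mono fun L hL => isTwistBlind_of_su2_mixedAction hL) μ hμ
  have e : (2 * ((4 - 1 : ℕ) : ℝ) * |β| * (2 : ℕ)) = 12 * |β| := by push_cast; ring
  rw [e] at h
  exact ⟨h.1, h.2.1⟩

/-- **SU(3), `d = 4`, `|β| < 1/18`, the adjoint axis at EVERY size `t`**: every limit state of every eventually-`adjointDensity 3 t`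
family obeys `HasAreaLawWith μ χ₃ 2 c`, `c = −log max(18|β|, 1/2)`, and `σ ≥ c` whenever its string tension exists. [folklore] -/
theorem su3_stringTension_adjointAction_dim4 {β : ℝ} (hβ : |β| < 1 / 18) (t : ℝ) :
    ∀ 𝓦 : PerturbationFamily 4 3, (∀ᶠ L : ℕ in atTop, IsPlaquetteAction (adjointDensity 3 t) (𝓦 L)) →
      ∀ μ ∈ perturbedLimitPoints β 𝓦,
        HasAreaLawWith μ (fun g => normalisedCharacter 3 (fundamentalRep (Fin 3) g)) 2
            (-Real.log (max (18 * |β|) (1 / 2))) ∧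
        (∀ σ : ℝ, HasStringTension μ (fun g => normalisedCharacter 3 (fundamentalRep (Fin 3) g)) σ →
            -Real.log (max (18 * |β|) (1 / 2)) ≤ σ) := by
  intro 𝓦 h𝓦 μ hμ
  have h := stringTension_adjointAction (d := 4) (N := 3) (by norm_num) (by norm_num) (β := β)
    (by push_cast; linarith) t 𝓦 h𝓦 μ hμ
  have e : (2 * ((4 - 1 : ℕ) : ℝ) * |β| * (3 : ℕ)) = 18 * |β| := by push_cast; ring
  rw [e] at h
  exact ⟨h.1, h.2.1⟩

/-! ### Consistency: the Wilson states (`W = 0`) -/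

/-- CONSISTENCY (the Wilson member, every `N ≥ 2`, `d ≥ 2`, `2(d−1)N|β| < 1`): every infinite-volume limit point of the `SU(N)`
WILSON states (the tree's `infiniteVolumeLimitPoints (fundamentalRep (Fin N)) β` = `perturbedLimitPoints β 0`) obeys
`HasAreaLawWith μ χ_N 2 c`, `c = −log max(2(d−1)N|β|, 1/2)` — a slab-free second proof of the tree's strong-coupling area law for
limit states in this window. [folklore] -/
theorem wilson_hasAreaLawWith_of_small [NeZero d] (hd : 2 ≤ d) (hN : 2 ≤ N) {β : ℝ}
    (hβ : 2 * ((d - 1 : ℕ) : ℝ) * |β| * N < 1) :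
    ∀ μ ∈ infiniteVolumeLimitPoints (d := d) (fundamentalRep (Fin N)) β,
      HasAreaLawWith μ (fun g => normalisedCharacter N (fundamentalRep (Fin N) g)) 2
        (-Real.log (max (2 * ((d - 1 : ℕ) : ℝ) * |β| * N) (1 / 2))) := by
  haveI : NeZero N := ⟨by omega⟩
  intro μ hμ
  rw [← perturbedLimitPoints_zero] at hμ
  exact (stringTension_twistBlind hd hN hβ 0
    (Eventually.of_forall fun L => (isCentreBlind_zero (d := d) (L := L + 1) (N := N)).isTwistBlind) μ hμ).1

end Summit.Ventures.YMGap.RobustBall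

end
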